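/-
Copyright (c) 2026 the pub-hodgecm-mathlib formalisation cell (harness21).  Prover seat hodgecm-mathlib-LH4-p09 (g8), req620 Track A «(D-RAM) FOUR-FRAME» squad
(heir LEAD F0P3a-plan (g20) T19-24 «STAGE-1b PRE-SCOPING BY IDLE HANDS: ALLOWED AS SCOPING»; dealer LH4-plan (g12)).  2026-09-04.
-/
import Summits.HodgeConjecture.HodgeConjecture.Theorems.F0P3cDyRamDiagonalPermutation        -- ★ §P (LH4-p13 (g2)): `image_mapGL_stratum`, `stabiliserWeight_mapGL_perm`, `coe_conj_eq_diagonal`, `isElementDatum_swap`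
import Summits.HodgeConjecture.HodgeConjecture.Theorems.F0P3cDyRamLevelCountDiagonalModel     -- ★ p858764 (this seat): `latticeInLevel_conj_mapGL_iff`; brings ★ U2G DEFS `LatticeInLevel`
import HarnessLib

/-!
# Crux `H413`, line LH4 «(D-RAM) FOUR-FRAME» road — STAGE-1b SCOPING BRICK «(L-model-P)»: COORDINATE PERMUTATIONS TRANSPORT THE LABELLED STRATUM SUMS — the ★ §P head with a
# diagonal level token riding along (`diag(e) ↦ diag(e ∘ π⁻¹)`), and the labelled `G2-from-G1` socket

Cell `hodgecm-mathlib` (D-0151), FLOOR 0, crux item H413 = `stmt-HodgeConjecture-24833`, route of record `HCCMUnconditional`; squad F0∕P3c∕LH4 (req618∕req620).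
THEOREMS ONLY (no `def`, no instance, no notation, no `sorry`, default heartbeats); lane `--supports stmt-HodgeConjecture-24833 --as helper` (count-neutral).
Consumers: the producers of the labelled Stage-B tables (★ p858861∕p858900 composites; ★ p859094 split strata; ★ p859257 the glued stratum G1).  ★ §P
`finsum_stabiliserWeight_stratum_perm` moves the UNLABELLED weight sum of `stratum(T, a)` to `stratum(P⁻¹TP, a ∘ π⁻¹)`; this file lets a diagonal level token ride along:
`diag(e)·(P·M) ⊆ ϖ^ℓ·(P·M) ↔ diag(e ∘ π⁻¹)·M ⊆ ϖ^ℓ·M` (§1), so the label-cut sums transport with `e ↦ e ∘ π⁻¹` (§2), and the G2 (`(2ρ+s, 2ρ, 2ρ+s)`) labelled eighth follows from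
any G1 statement by the swap `(0 1)` exactly as ★ `finsum_stabiliserWeight_stratum_G2_of_G1` (§3; the G3 rescaling twin needs the unit homothety on the token too and is left
to the producer who fixes the G1 table of record).

THE MATHEMATICS ([Kottwitz1986BaseChangeUnits, §1]; [Serre1980Trees, II §1.1]).  For the permutation matrix `P` of `π`: `P⁻¹·diag(e)·P = diag(e ∘ π⁻¹)` (★
`permMatrix_inv_mul_diagonal_mul`), hence `diag(e) = P·diag(e ∘ π⁻¹)·P⁻¹` and ★ p858764 `latticeInLevel_conj_mapGL_iff` gives §1; `P·stratum(P⁻¹TP, a∘π⁻¹) = stratum(T, a)` (★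
`image_mapGL_stratum`) restricts to the label-cut parts, the weight is `P`-invariant (★ `stabiliserWeight_mapGL_perm`).
* §1 `conj_diagonal_comp_symm_eq`, `latticeInLevel_diagonal_mapGL_perm_iff`.
* §2 `image_mapGL_stratum_sep_latticeInLevel`, HEAD `finsum_stabiliserWeight_stratum_sep_latticeInLevel_perm`.
* §3 `finsum_stabiliserWeight_stratum_G2_sep_of_G1` (labelled twin of ★ `finsum_stabiliserWeight_stratum_G2_of_G1`, hypothesis form).
HONEST LABEL.  Count-neutral (`--supports`); bookkeeping, nothing printed is asserted; pays NO tier-0 row; `HC_CM` is proved only modulo the 7 printed citations (2 remaining named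
inputs: hLiu418 = `stmt-HodgeConjecture-24832`, h413 = `stmt-HodgeConjecture-24833`) until rung 0 closes.

## References
* [Kottwitz1986BaseChangeUnits] R. E. Kottwitz, *Base change for unit elements of Hecke algebras*, Compositio Math. 60 (1986), §1 pp. 240–241 (lattice counts modulo the torus).
* [Serre1980Trees] J.-P. Serre, *Trees*, Springer (1980), Ch. II §1.1 (lattices and the diagonal action).
* [Rogawski1990] J. D. Rogawski, *Automorphic Representations of Unitary Groups in Three Variables*, Ann. of Math. Stud. 123 (1990), §4.9 Prop. 4.9.1 (a) p. 55.
-/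

set_option autoImplicit false

noncomputable section

namespace Summit.HodgeConjecture.HodgeConjecture.Cruxes.H413.F0P3cDyRamLabelledStrataPermutation

open Literature.NumberTheory.Automorphic Literature.NumberTheory.Automorphic.HermitianLattice
open Literature.NumberTheory.Automorphic.UnitaryLatticeTree Literature.NumberTheory.Automorphic.UnitaryThreeFourFrame
open Summit.HodgeConjecture.HodgeConjecture.Cruxes.H413.F0P3cDyRamDiagonalTorusDefs
open Summit.HodgeConjecture.HodgeConjecture.Cruxes.H413.F0P3cDyRamDiagonalStrataDefs
open Summit.HodgeConjecture.HodgeConjecture.Cruxes.H413.F0P3cDyRamDiagonalPermutation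
open Summit.HodgeConjecture.HodgeConjecture.Cruxes.H413.F0P3cDyRamFourFrameCensusDefs
open Summit.HodgeConjecture.HodgeConjecture.Cruxes.H413.F0P3cDyRamLevelCountDiagonalModel
open scoped Valued WithZero Matrix MatrixGroups

/-! ## §1  A diagonal level token under a coordinate permutation -/

section Token

variable {K : Type*} [Field K] [Valued K ℤᵐ⁰] {N : ℕ}

omit [Valued K ℤᵐ⁰] in
/-- `P·diag(e ∘ π⁻¹)·P⁻¹ = diag(e)` for the permutation matrix `P` of `π` (★ `permMatrix_inv_mul_diagonal_mul` read backwards). [cite: Serre1980Trees, II §1.1] -/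
theorem conj_diagonal_comp_symm_eq {π : Equiv.Perm (Fin N)} (P : GL (Fin N) K) (hP : (P : Matrix (Fin N) (Fin N) K) = π.permMatrix K) (e : Fin N → K) :
    (P : Matrix (Fin N) (Fin N) K) * Matrix.diagonal (e ∘ ⇑π.symm) * ((P⁻¹ : GL (Fin N) K) : Matrix (Fin N) (Fin N) K) = Matrix.diagonal e := by
  rw [← permMatrix_inv_mul_diagonal_mul π e, ← coe_inv_eq_permMatrix_inv P hP, ← hP]
  simp only [Matrix.mul_assoc, Units.mul_inv, Matrix.mul_one]
  rw [← Matrix.mul_assoc, Units.mul_inv, Matrix.one_mul]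

/-- **A DIAGONAL LEVEL TOKEN UNDER A COORDINATE PERMUTATION**: `diag(e)·(P·M) ⊆ ϖ^ℓ·(P·M) ↔ diag(e ∘ π⁻¹)·M ⊆ ϖ^ℓ·M` (★ p858764 `latticeInLevel_conj_mapGL_iff` + §1).
[cite: Kottwitz1986BaseChangeUnits, §1 pp. 240–241] -/
theorem latticeInLevel_diagonal_mapGL_perm_iff {π : Equiv.Perm (Fin 3)} (P : GL (Fin 3) K) (hP : (P : Matrix (Fin 3) (Fin 3) K) = π.permMatrix K)
    (ϖ : K) (ℓ : ℕ) (e : Fin 3 → K) (M : Submodule 𝒪[K] (Fin 3 → K)) :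
    LatticeInLevel ϖ ℓ (Matrix.diagonal e) (mapGL P M) ↔ LatticeInLevel ϖ ℓ (Matrix.diagonal (e ∘ ⇑π.symm)) M := by
  rw [← conj_diagonal_comp_symm_eq P hP e, latticeInLevel_conj_mapGL_iff]

end Token

/-! ## §2  The label-cut stratum sums transport under coordinate permutations -/

section Transport

variable {K : Type*} [Field K] [Valued K ℤᵐ⁰] {N : ℕ}

/-- `P · {M ∈ stratum(P⁻¹TP, a∘π⁻¹) : diag(e∘π⁻¹)M ⊆ ϖ^ℓM} = {M ∈ stratum(T, a) : diag(e)M ⊆ ϖ^ℓM}` (★ `image_mapGL_stratum` + §1). [cite: Kottwitz1986BaseChangeUnits, §1 pp. 240–241] -/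
theorem image_mapGL_stratum_sep_latticeInLevel (σ : K →+* K) (ϖ : K) {π : Equiv.Perm (Fin 3)} (P : GL (Fin 3) K)
    (hP : (P : Matrix (Fin 3) (Fin 3) K) = π.permMatrix K) (T : GL (Fin 3) K) (a : Fin 3 → ℕ) (ℓ : ℕ) (e : Fin 3 → K) :
    mapGL P '' {M | M ∈ stratum σ ϖ (P⁻¹ * T * P) (a ∘ ⇑π.symm) ∧ LatticeInLevel ϖ ℓ (Matrix.diagonal (e ∘ ⇑π.symm)) M} =
      {M | M ∈ stratum σ ϖ T a ∧ LatticeInLevel ϖ ℓ (Matrix.diagonal e) M} := by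
  have himg := image_mapGL_stratum σ ϖ P hP T a
  ext M'
  constructor
  · rintro ⟨M, ⟨hM, hQ⟩, rfl⟩
    have h1 : mapGL P M ∈ stratum σ ϖ T a := by rw [← himg]; exact ⟨M, hM, rfl⟩
    exact ⟨h1, (latticeInLevel_diagonal_mapGL_perm_iff P hP ϖ ℓ e M).2 hQ⟩
  · rintro ⟨hM', hQ'⟩
    have h1 : M' ∈ mapGL P '' stratum σ ϖ (P⁻¹ * T * P) (a ∘ ⇑π.symm) := by rw [himg]; exact hM'
    obtain ⟨M, hM, rfl⟩ := h1
    exact ⟨M, ⟨hM, (latticeInLevel_diagonal_mapGL_perm_iff P hP ϖ ℓ e M).1 hQ'⟩, rfl⟩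

/-- **HEAD — THE LABEL-CUT WEIGHT SUM OF A STRATUM IS INVARIANT UNDER A COORDINATE PERMUTATION, THE TOKEN RIDING ALONG**:
`Σᶠ_{M ∈ stratum(T, a), diag(e)M ⊆ ϖ^ℓM} 1∕[𝒰 : S_F(M)] = Σᶠ_{M ∈ stratum(P⁻¹TP, a∘π⁻¹), diag(e∘π⁻¹)M ⊆ ϖ^ℓM} 1∕[𝒰 : S_F(M)]` (labelled twin of ★
`finsum_stabiliserWeight_stratum_perm`; for `T = diag(d)`, `P⁻¹TP = diag(d ∘ π⁻¹)` by ★ `coe_conj_eq_diagonal`). [cite: Kottwitz1986BaseChangeUnits, §1 pp. 240–241]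
[cite: Rogawski1990, §4.9 Prop. 4.9.1 (a) p. 55] -/
theorem finsum_stabiliserWeight_stratum_sep_latticeInLevel_perm (σ : K →+* K) (ϖ : K) {π : Equiv.Perm (Fin 3)} (P : GL (Fin 3) K)
    (hP : (P : Matrix (Fin 3) (Fin 3) K) = π.permMatrix K) (T : GL (Fin 3) K) (a : Fin 3 → ℕ) (ℓ : ℕ) (e : Fin 3 → K) :
    ∑ᶠ M ∈ {M | M ∈ stratum σ ϖ T a ∧ LatticeInLevel ϖ ℓ (Matrix.diagonal e) M}, stabiliserWeight σ M =
      ∑ᶠ M ∈ {M | M ∈ stratum σ ϖ (P⁻¹ * T * P) (a ∘ ⇑π.symm) ∧ LatticeInLevel ϖ ℓ (Matrix.diagonal (e ∘ ⇑π.symm)) M}, stabiliserWeight σ M := by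
  rw [← image_mapGL_stratum_sep_latticeInLevel σ ϖ P hP T a ℓ e, finsum_mem_image (mapGL_injective P).injOn]
  exact finsum_mem_congr rfl fun M _ => stabiliserWeight_mapGL_perm σ P hP M

end Transport

/-! ## §3  The labelled `G2-from-G1` socket (swap `(0 1)`) -/

section Sockets

variable {K : Type} [Field K] [Valued K ℤᵐ⁰] {σ : K →+* K} {ϖ : K} {α β : K} {N₀ n₁ n₂ n₃ : ℕ} {T : GL (Fin 3) K}

/-- **LABELLED `G2` FROM ANY LABELLED `G1` STATEMENT** (the swap `(0 1)`: `diag(α, β, 1) ↦ diag(β, α, 1)`, depths `(n₁, n₂, n₃) ↦ (n₂, n₁, n₃)`, token `diag(e₀, e₁, e₂) ↦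
diag(e₁, e₀, e₂)`): if for every element datum the label-cut G1 sum is `F(n′, e′)`, then the label-cut G2 sum at `(T, e)` is `F((n₂, n₁, n₃), (e₁, e₀, e₂))` (labelled twin
of ★ `finsum_stabiliserWeight_stratum_G2_of_G1`). [cite: Kottwitz1986BaseChangeUnits, §1 pp. 240–241] [cite: Rogawski1990, §4.9 Prop. 4.9.1 (a) p. 55] -/
theorem finsum_stabiliserWeight_stratum_G2_sep_of_G1 (hE : IsElementDatum σ ϖ N₀ α β n₁ n₂ n₃)
    (hT : (T : Matrix (Fin 3) (Fin 3) K) = Matrix.diagonal ![α, β, 1]) (ρ s ℓ : ℕ) (e : Fin 3 → K) (F : ℕ → ℕ → ℕ → (Fin 3 → K) → ℚ)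
    (hG1 : ∀ {α' β' : K} {n₁' n₂' n₃' : ℕ} (T' : GL (Fin 3) K) (e' : Fin 3 → K), IsElementDatum σ ϖ N₀ α' β' n₁' n₂' n₃' →
      (T' : Matrix (Fin 3) (Fin 3) K) = Matrix.diagonal ![α', β', 1] →
        ∑ᶠ M ∈ {M | M ∈ stratum σ ϖ T' ![2 * ρ, 2 * ρ + s, 2 * ρ + s] ∧ LatticeInLevel ϖ ℓ (Matrix.diagonal e') M}, stabiliserWeight σ M = F n₁' n₂' n₃' e') :
    ∑ᶠ M ∈ {M | M ∈ stratum σ ϖ T ![2 * ρ + s, 2 * ρ, 2 * ρ + s] ∧ LatticeInLevel ϖ ℓ (Matrix.diagonal e) M}, stabiliserWeight σ M =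
      F n₂ n₁ n₃ ![e 1, e 0, e 2] := by
  obtain ⟨P, hP⟩ := exists_gl_coe_eq_permMatrix (K := K) (Equiv.swap (0 : Fin 3) 1)
  rw [finsum_stabiliserWeight_stratum_sep_latticeInLevel_perm σ ϖ P hP T _ ℓ e]
  have ha : (![2 * ρ + s, 2 * ρ, 2 * ρ + s] : Fin 3 → ℕ) ∘ ⇑(Equiv.swap (0 : Fin 3) 1).symm = ![2 * ρ, 2 * ρ + s, 2 * ρ + s] := by
    ext i; fin_cases i <;> rfl
  have hd : (![α, β, 1] : Fin 3 → K) ∘ ⇑(Equiv.swap (0 : Fin 3) 1).symm = ![β, α, 1] := by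
    ext i; fin_cases i <;> rfl
  have he : e ∘ ⇑(Equiv.swap (0 : Fin 3) 1).symm = ![e 1, e 0, e 2] := by
    ext i; fin_cases i <;> rfl
  rw [ha, he]
  exact hG1 _ _ (isElementDatum_swap hE) (by rw [coe_conj_eq_diagonal P hP T hT, hd])

end Sockets

end Summit.HodgeConjecture.HodgeConjecture.Cruxes.H413.F0P3cDyRamLabelledStrataPermutation

end
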